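import Summits.QuantumFields.BalabanUV.T4Continuum.Support.ShellMeasureRootComposition
import Summits.QuantumFields.BalabanUV.T4Continuum.Support.ShellMeasureRootCompositionSU2

/-!
# `T4Continuum.ShellMeasureRootCompositionSeam` — NE7c ROOT COMPOSITION, THE SEAM END-I ∘ END-II: END-I for the cell's
# REALIZED `SU(2)` slot measures `(fieldMeasure P j SU2).withDensity F` from per-slot (M1) with SLOT constants (END-II's
# outputs), the finiteness instance discharged from `∫⁻ F ∂fieldMeasure ≠ ∞` per slot and the slot→level majorant
# displayed — kernel bookkeeping, no estimate
# (cell `pub-balaban`, sub-cell `t4`, spine estimate NE7c (node U5b); NE7c ROUND-2 crew seat leaf-08, row S13 «SEAM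
# END-I ∘ END-II» of the claim table `t4/b2b-balaban-t4-ne7c-p1/LEAVES-NE7c-P1.md`, RECUT by the row owner t4-ne7c-p1-g26
# from XREAD C-ne7cleaf08-1 INFO-1∕INFO-2; ADDITIVE — imports `ShellMeasureRootComposition` (END-I, p207618) and
# `ShellMeasureRootCompositionSU2` (END-II, p207698) only; 0 `def`, 0 sorry, 0 citations)

HONEST FRAMING.  Finite four-torus programme, rung (B)+1 only — NOT infinite volume, NOT a mass gap, NOT the Clay
problem, NOT summit progress; (B), `BetaPertHyp`, (B^μ) not consumed.  NE7c = `T4IndicatorShell.ShellWeightBound` is NOT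
PRINTED in [Balaban 1983–89] and NOT PROVED; (M1) for Bałaban's inductively defined effective measures is NOT PRINTED
(GAPS G-ne7cp1-1), asserted by nobody and NOT moved here.  This file is BOOKKEEPING at the junction of the two landed
compositions (trigger c3 «NE7c ⇐ the named binders»): END-I (`ShellMeasureRootComposition.shellWeightBound_of_slotAC`,
row S7a) asks per run for realized FINITE measures `μ K t s` (an INSTANCE binder `[∀ K t s, IsFiniteMeasure (μ K t s)]`)
and for (M1) per slot with a constant indexed by the LEVEL, `D (lvl K s)`; END-II
(`ShellMeasureRootCompositionSU2.slotAC_realized_su2_of_levelData`, row S7b) delivers per slot (M1) for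
`(fieldMeasure P j SU2).withDensity F` with a constant indexed by the SLOT's block data,
`2(n + β Σ_{p∈P_w} L̄_p(d̄_p + 4s̄_p) + B_𝓔)∕(1−δ)` (`n = 3·#Λ`), and its hypotheses do not make that measure finite (its
`hfin` is per exterior section, on the block law).  The two displayed book-keeping facts closing the seam: (i) per slot
`∫⁻ F ∂fieldMeasure ≠ ∞` (level 0: `F ≤ 1`, `fieldMeasure` a probability measure — §1), giving the instance by
`MeasureTheory.isFiniteMeasure_withDensity`; (ii) per level `j` a majorant `D_j` of the slot constants at level `j`
(uniform block geometry per level — row S4's «uniform in k» packaging), transported by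
`T4ShellMeasureFibre.slotAntiConcentration_mono`.  Every estimate binder of END-I∕END-II stays displayed.  HONEST
DEPENDENCY (cell): continuum YM on T⁴ ⇐ BetaPertH ∧ nine spine estimates (0/9 proved); BetaPertH ⇐ (D1) ∧ (D4) ∧
CAP+tail; G-an2-4 gates asym, D1 and NE2/3/4.

## What is proved ([folklore] bookkeeping)
* §1 `lintegral_ne_top_of_le_const`, `isFiniteMeasure_withDensity_of_le_const`, `isFiniteMeasure_realized_su2(_of_le)`.
* §2 `hac_of_slotConst` (any slot family: (M1) per slot with SLOT constants `Dslot K t s ≤ D (lvl K s)` ⟹ END-I's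
  `hac` with LEVEL constants), `hac_of_levelData` (the same for the realized `SU(2)` family — END-II's output shape).
* §3 `slotAC_realized_su2_of_levelData_le`: END-II for ONE slot composed with a displayed level majorant
  `2(n + …)∕(1−δ) ≤ D_j` ((SM) in the clean form `36H∕(Rad−1)² ≤ δθ`) — the per-slot supplier of §2's `hac`.
* §4 `levelLedger_of_levelDataSU2`, `shellWeightBound_of_levelDataSU2` (END-I for two realized `SU(2)` slot families,
  the `IsFiniteMeasure` instances discharged inside from (i), the majorants (ii) displayed), `…_band` (road P2's band
  twin), `hybridNE7_tail_of_levelDataSU2` (through the seam (ζ′) socket).  Conclusions LITERALLY END-I's.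
WHAT THIS DOES NOT DO.  No estimate binder discharged (SM-L1…L8 displayed); (M1), NE7c NOT proved; 0/9 spine.
-/

noncomputable section

open Finset MeasureTheory
open scoped ENNReal

namespace Summit.QuantumFields.BalabanUV.T4Continuum.ShellMeasureRootCompositionSeam

open Literature.MathematicalPhysics.QuantumFieldTheory.Balaban1983to89
open T4WeightBudget T4IndicatorShell T4MatchingAssembly T4MatchingClosure T4MatchingClosureSocket
open T4ShellMeasure (SlotAntiConcentration)
open T4ShellMeasureFibre (slotAntiConcentration_mono)
open T4ShellMeasureLevels (LevelLedger LiveWindow)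
open T4CubeChartGnomonic (SU2)
open ShellMeasureRootComposition (levelLedger_of_slotAC shellWeightBound_of_slotAC shellWeightBound_of_slotAC_band
  hybridNE7_tail_of_slotAC)

/-! ## §1 Finiteness of the realized slot measures (seam fact (i)) -/

section Finite
/-- a density bounded by a finite constant has finite integral against a finite measure. [folklore] -/
theorem lintegral_ne_top_of_le_const {Ω : Type*} [MeasurableSpace Ω] (μ : Measure Ω) [IsFiniteMeasure μ]
    {F : Ω → ℝ≥0∞} {C : ℝ≥0∞} (hC : C ≠ ∞) (hF : ∀ x, F x ≤ C) : ∫⁻ x, F x ∂μ ≠ ∞ := by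
  refine ne_top_of_le_ne_top (ENNReal.mul_ne_top hC (measure_ne_top μ Set.univ)) ?_
  calc ∫⁻ x, F x ∂μ ≤ ∫⁻ _, C ∂μ := lintegral_mono hF
    _ = C * μ Set.univ := lintegral_const C

/-- a finite measure tilted by a density bounded by a finite constant is finite. [folklore] -/
theorem isFiniteMeasure_withDensity_of_le_const {Ω : Type*} [MeasurableSpace Ω] (μ : Measure Ω) [IsFiniteMeasure μ]
    {F : Ω → ℝ≥0∞} {C : ℝ≥0∞} (hC : C ≠ ∞) (hF : ∀ x, F x ≤ C) : IsFiniteMeasure (μ.withDensity F) :=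
  isFiniteMeasure_withDensity (lintegral_ne_top_of_le_const μ hC hF)

/-- **SEAM FACT (i).**  The cell's realized slot measure `(fieldMeasure P j SU2).withDensity F` (product Haar tilted by
the run's integrand, own indicator removed — reading (R)) is FINITE once `∫⁻ F ∂fieldMeasure ≠ ∞`. [folklore] -/
theorem isFiniteMeasure_realized_su2 {P : Params} {j : ℕ} {F : GaugeField P j SU2 → ℝ≥0∞}
    (hF : ∫⁻ U, F U ∂(fieldMeasure P j SU2) ≠ ∞) : IsFiniteMeasure ((fieldMeasure P j SU2).withDensity F) :=
  isFiniteMeasure_withDensity hF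

/-- … in particular for a density bounded by a finite constant (`fieldMeasure` is a probability measure; at level 0
the gauge-invariant small-field Wilson density is `≤ 1`). [folklore] -/
theorem isFiniteMeasure_realized_su2_of_le {P : Params} {j : ℕ} {F : GaugeField P j SU2 → ℝ≥0∞} {C : ℝ≥0∞}
    (hC : C ≠ ∞) (hF : ∀ U, F U ≤ C) : IsFiniteMeasure ((fieldMeasure P j SU2).withDensity F) :=
  isFiniteMeasure_withDensity_of_le_const _ hC hF

end Finite

/-! ## §2 Slot constants to level constants (seam fact (ii)) -/

section SlotToLevel
variable {σ : Type*} {Ω : ℕ → σ → Type*} [∀ K s, MeasurableSpace (Ω K s)] {l₀ : ℝ} {S : ℕ → Finset σ}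
  {lvl : ℕ → σ → ℕ} {μ : ∀ K : ℕ, ℝ → ∀ s : σ, Measure (Ω K s)} {u : ∀ K : ℕ, ℝ → ∀ s : σ, Ω K s → ℝ}
  {θ D ρ : ℕ → ℝ} {Dslot : ℕ → ℝ → σ → ℝ}

/-- **SEAM FACT (ii), ANY SLOT FAMILY.**  (M1) per slot with a SLOT constant `Dslot K t s`, a displayed LEVEL majorant
`Dslot K t s ≤ D (lvl K s)` and `0 ≤ ρ_j` ⟹ END-I's wall binder `hac` (constant by level), by monotonicity of (M1) in
the constant (`T4ShellMeasureFibre.slotAntiConcentration_mono`). [folklore] -/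
theorem hac_of_slotConst (hρ : ∀ j, 0 ≤ ρ j)
    (hDslot : ∀ K t, |t| ≤ l₀ → ∀ s ∈ S K, Dslot K t s ≤ D (lvl K s))
    (hac : ∀ K t, |t| ≤ l₀ → ∀ s ∈ S K,
      SlotAntiConcentration (μ K t s) (u K t s) (θ (lvl K s)) (ρ (lvl K s)) (Dslot K t s)) :
    ∀ K t, |t| ≤ l₀ → ∀ s ∈ S K,
      SlotAntiConcentration (μ K t s) (u K t s) (θ (lvl K s)) (ρ (lvl K s)) (D (lvl K s)) :=
  fun K t ht s hs => slotAntiConcentration_mono (hρ _) (hDslot K t ht s hs) (hac K t ht s hs)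

end SlotToLevel

/-- **SEAM FACT (ii) FOR THE REALIZED `SU(2)` SLOT FAMILY** (END-II's output shape): slots `s ∈ S K` at levels
`lvl K s`, densities `F K t s`, variables `u K t s`; (M1) with SLOT constants + level majorants ⟹ END-I's `hac`. [folklore] -/
theorem hac_of_levelData {σ : Type*} {P : Params} {l₀ : ℝ} {S : ℕ → Finset σ} {lvl : ℕ → σ → ℕ}
    {F : ∀ K : ℕ, ℝ → ∀ s : σ, GaugeField P (lvl K s) SU2 → ℝ≥0∞}
    {u : ∀ K : ℕ, ℝ → ∀ s : σ, GaugeField P (lvl K s) SU2 → ℝ} {θ D ρ : ℕ → ℝ} {Dslot : ℕ → ℝ → σ → ℝ}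
    (hρ : ∀ j, 0 ≤ ρ j) (hDslot : ∀ K t, |t| ≤ l₀ → ∀ s ∈ S K, Dslot K t s ≤ D (lvl K s))
    (hac : ∀ K t, |t| ≤ l₀ → ∀ s ∈ S K,
      SlotAntiConcentration ((fieldMeasure P (lvl K s) SU2).withDensity (F K t s)) (u K t s)
        (θ (lvl K s)) (ρ (lvl K s)) (Dslot K t s)) :
    ∀ K t, |t| ≤ l₀ → ∀ s ∈ S K,
      SlotAntiConcentration ((fieldMeasure P (lvl K s) SU2).withDensity (F K t s)) (u K t s)
        (θ (lvl K s)) (ρ (lvl K s)) (D (lvl K s)) :=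
  hac_of_slotConst (μ := fun K t s => (fieldMeasure P (lvl K s) SU2).withDensity (F K t s)) hρ hDslot hac

/-! ## §3 One slot: END-II composed with a displayed level majorant -/

section OneSlot
open NormedSpace Set Metric
open T4CubePoincare (cube)
open T4CubeChartExp (expWindowDensity expFibreChart)
open T4ShellMeasureDet (blockLaw)
open T4TreeGaugeFixing (NoClosedLoop fixTo)
open ShellMeasureWilsonTrace (TraceData)
open ShellMeasureWilsonMoving (MLetter mwordEval mdFro sSum lSum)
open ShellMeasureLevelAssembly (classifier weight)
open ShellMeasureRootCompositionSU2 (slotAC_realized_su2_of_levelData)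
open GaugeField (GaugeInvariant)
open Function (updateFinset)

variable {P : Params} {j : ℕ} [DecidableEq (PBond P j)]
variable {A : Type*} [NormedRing A] [NormedAlgebra ℂ A] [CompleteSpace A] [NormOneClass A]

/-- **END-II WITH A LEVEL MAJORANT, ONE SLOT.**  The binders of
`ShellMeasureRootCompositionSU2.slotAC_realized_su2_of_levelData` verbatim (the (SM) binder in the clean form
`36H∕(Rad − 1)² ≤ δθ`), plus ONE displayed majorant `2(n + β Σ_p L̄_p(d̄_p + 4s̄_p) + B_𝓔)∕(1−δ) ≤ D_j` of the slot
constant by a level constant ⟹ (M1) for the realized slot measure with constant `D_j` — the per-slot input of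
`hac_of_levelData`. CONDITIONAL on every binder; nothing PRINTED is asserted. [folklore] -/
theorem slotAC_realized_su2_of_levelData_le {T : Finset (PBond P j)} (hT : NoClosedLoop T)
    (U₀ : GaugeField P j SU2) (Λ : Finset (PBond P j)) {n : ℕ} (e : ↥Λ × Fin 3 ≃ Fin n)
    {S : ℝ} (hS : 0 < S) (hSπ : 3 * S ^ 2 < Real.pi ^ 2) (c : GaugeField P j SU2 → GaugeField P j SU2)
    {R : GaugeField P j SU2 → (↥Λ → SU2) → ℝ≥0∞} (hR : ∀ V, Measurable (R V))
    {F : GaugeField P j SU2 → ℝ≥0∞} (hF : Measurable F) (hFi : GaugeInvariant F)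
    (hFw : ∀ V y, F (fixTo T U₀ (updateFinset V Λ y)) =
      ENNReal.ofReal (expWindowDensity Λ (c V) S (updateFinset (c V) Λ y)) * R V y)
    (hfin : ∀ V, ((blockLaw Λ).withDensity fun y => F (fixTo T U₀ (updateFinset V Λ y))) univ ≠ ∞)
    {u : GaugeField P j SU2 → ℝ} (hu : Measurable u) (hui : GaugeInvariant u)
    (Ttr : TraceData A) (hN : 0 < Ttr.N) {ι κ : Type*} {Pu : Finset ι} (hPu : Pu.Nonempty)
    (hol : GaugeField P j SU2 → ι → (Fin n → ℝ) → A) (hcont : ∀ V, ∀ p ∈ Pu, Continuous (hol V p))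
    (Pw : Finset κ) (G : GaugeField P j SU2 → κ → (Fin n → ℝ) → A) (𝓔 : GaugeField P j SU2 → (Fin n → ℝ) → ℝ)
    (W : GaugeField P j SU2 → Set (Fin n → ℝ)) (Jco : GaugeField P j SU2 → (Fin n → ℝ) → ℝ≥0∞)
    {θ δ ρ β Rad H B𝓔 Dj : ℝ} {sw lw dw : κ → ℝ}
    (hRdict : ∀ V x, R V (expFibreChart Λ (c V) e x) = Jco V x * weight Ttr β Pw (G V) (𝓔 V) x)
    (hudict : ∀ V x, u (fixTo T U₀ (updateFinset V Λ (expFibreChart Λ (c V) e x))) = classifier hPu (hol V) x)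
    (hJW : ∀ V x, Jco V x ≠ 0 → x ∈ W V)
    (hJ : ∀ V x, ∀ a : ℝ, 0 ≤ a → Jco V x ≤ Jco V (Real.exp (-a) • x))
    (hRad : 1 < Rad)
    (hAN : ∀ V, ∀ x ∈ W V, ∀ p ∈ Pu, ∃ f : ℂ → A, DifferentiableOn ℂ f (ball 0 Rad) ∧
      (∀ w ∈ ball (0 : ℂ) Rad, ‖f w‖ ≤ H) ∧ f 0 = 0 ∧ ∀ c' : ℝ, 0 ≤ c' → c' ≤ 1 → f (c' : ℂ) = hol V p (c' • x) - 1)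
    (hGW : ∀ V, ∀ x ∈ W V, ∀ p ∈ Pw, ∃ gw : List (MLetter A × ℝ × ℝ), (∀ y ∈ gw, y.1.Good Ttr.τ y.2.1 y.2.2) ∧
      sSum gw ≤ sw p ∧ lSum gw ≤ lw p ∧ mdFro (gw.map Prod.fst) ≤ dw p ∧
      ∀ c' : ℝ, 0 ≤ c' → c' ≤ 1 → mwordEval c' (gw.map Prod.fst) = G V p (c' • x))
    (hsw1 : ∀ p ∈ Pw, sw p ≤ 1) (hsw0 : ∀ p ∈ Pw, 0 ≤ sw p) (hlw0 : ∀ p ∈ Pw, 0 ≤ lw p)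
    (hdw0 : ∀ p ∈ Pw, 0 ≤ dw p)
    (hE : ∀ V, ∀ x ∈ W V, ∀ c' : ℝ, 1 / 2 ≤ c' → c' ≤ 1 → 𝓔 V (c' • x) ≤ 𝓔 V x + (1 - c') * B𝓔) (hB𝓔 : 0 ≤ B𝓔)
    (hθ : 0 < θ) (hδ0 : 0 ≤ δ) (hδ1 : δ < 1) (hρ0 : 0 ≤ ρ) (hρ : ρ ≤ (1 - δ) / 2) (hβ : 0 ≤ β)
    (hSM : 36 * H / (Rad - 1) ^ 2 ≤ δ * θ)
    -- the displayed level majorant of the slot constant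
    (hDj : 2 * ((n : ℝ) + (β * ∑ p ∈ Pw, lw p * (dw p + 4 * sw p) + B𝓔)) / (1 - δ) ≤ Dj) :
    SlotAntiConcentration ((fieldMeasure P j SU2).withDensity F) u θ ρ Dj :=
  slotAntiConcentration_mono hρ0 hDj
    (slotAC_realized_su2_of_levelData hT U₀ Λ e hS hSπ c hR hF hFi hFw hfin hu hui Ttr hN hPu hol hcont Pw G 𝓔 W
      Jco hRdict hudict hJW hJ hRad hAN hGW hsw1 hsw0 hlw0 hdw0 hE hB𝓔 hθ hδ0 hδ1 hρ0 hρ hβ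
      (by simpa only [one_pow, mul_one] using hSM))

end OneSlot

/-! ## §4 END-I for realized `SU(2)` slot families: the instance discharged, the majorants displayed -/

section OneRun
variable {ι σ : Type*} {P : Params} {l₀ : ℝ} {T : ℕ → Finset ι} {A sh : ℕ → ℝ → ι → ℝ} {S : ℕ → Finset σ}
  {piece : ℕ → ℝ → σ → ι → ℝ} {lvl : ℕ → σ → ℕ}
  {F : ∀ K : ℕ, ℝ → ∀ s : σ, GaugeField P (lvl K s) SU2 → ℝ≥0∞}
  {u : ∀ K : ℕ, ℝ → ∀ s : σ, GaugeField P (lvl K s) SU2 → ℝ} {θ D ρ : ℕ → ℝ} {Dslot M : ℕ → ℝ → σ → ℝ}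

/-- **ONE RUN: THE LEVEL LEDGER FROM REALIZED `SU(2)` SLOT DATA.**  END-I's `levelLedger_of_slotAC` with
`μ K t s := (fieldMeasure P (lvl K s) SU2).withDensity (F K t s)`: binders (R) `sh_nonneg`/`sh_le`/`cover`, [dict]
`hM`/`piece_le`/`total_ge`, signs, PLUS seam fact (i) `hFfin` (the `IsFiniteMeasure` instance is discharged inside) and
(M1) per slot with SLOT constants `hac` + level majorants `hDslot` (ii) ⊢ `LevelLedger l₀ T A sh S piece lvl D ρ`. [folklore] -/
theorem levelLedger_of_levelDataSU2
    (hFfin : ∀ K t s, ∫⁻ U, F K t s U ∂(fieldMeasure P (lvl K s) SU2) ≠ ∞)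
    (sh_nonneg : ∀ K t, |t| ≤ l₀ → ∀ τ ∈ T K, 0 ≤ sh K t τ)
    (sh_le : ∀ K t, |t| ≤ l₀ → ∀ τ ∈ T K, sh K t τ ≤ A K t τ)
    (cover : ∀ K t, |t| ≤ l₀ → ∀ τ ∈ T K, sh K t τ ≤ ∑ s ∈ S K, piece K t s τ)
    (hM : ∀ K t, |t| ≤ l₀ → ∀ s ∈ S K, 0 ≤ M K t s)
    (piece_le : ∀ K t, |t| ≤ l₀ → ∀ s ∈ S K, ∑ τ ∈ T K, piece K t s τ ≤ M K t s *
      (((fieldMeasure P (lvl K s) SU2).withDensity (F K t s))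
        {x | θ (lvl K s) * (1 - ρ (lvl K s)) ≤ u K t s x ∧ u K t s x < θ (lvl K s)}).toReal)
    (total_ge : ∀ K t, |t| ≤ l₀ → ∀ s ∈ S K,
      M K t s * (((fieldMeasure P (lvl K s) SU2).withDensity (F K t s)) Set.univ).toReal ≤ ∑ τ ∈ T K, A K t τ)
    (hD : ∀ j, 0 ≤ D j) (hρ : ∀ j, 0 ≤ ρ j)
    (hDslot : ∀ K t, |t| ≤ l₀ → ∀ s ∈ S K, Dslot K t s ≤ D (lvl K s))
    (hac : ∀ K t, |t| ≤ l₀ → ∀ s ∈ S K,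
      SlotAntiConcentration ((fieldMeasure P (lvl K s) SU2).withDensity (F K t s)) (u K t s)
        (θ (lvl K s)) (ρ (lvl K s)) (Dslot K t s)) :
    LevelLedger l₀ T A sh S piece lvl D ρ :=
  haveI : ∀ K t s, IsFiniteMeasure ((fieldMeasure P (lvl K s) SU2).withDensity (F K t s)) :=
    fun K t s => isFiniteMeasure_withDensity (hFfin K t s)
  levelLedger_of_slotAC (μ := fun K t s => (fieldMeasure P (lvl K s) SU2).withDensity (F K t s))
    sh_nonneg sh_le cover hM piece_le total_ge hD hρ (hac_of_levelData hρ hDslot hac)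

end OneRun

section TwoRuns
variable {ι σ σ' : Type*} {P : Params} {l₀ : ℝ} {T : ℕ → Finset ι} {A B shA shB : ℕ → ℝ → ι → ℝ}
  {SA : ℕ → Finset σ} {SB : ℕ → Finset σ'} {pieceA : ℕ → ℝ → σ → ι → ℝ} {pieceB : ℕ → ℝ → σ' → ι → ℝ}
  {lvlA : ℕ → σ → ℕ} {lvlB : ℕ → σ' → ℕ}
  {FA : ∀ K : ℕ, ℝ → ∀ s : σ, GaugeField P (lvlA K s) SU2 → ℝ≥0∞}
  {FB : ∀ K : ℕ, ℝ → ∀ s : σ', GaugeField P (lvlB K s) SU2 → ℝ≥0∞}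
  {uA : ∀ K : ℕ, ℝ → ∀ s : σ, GaugeField P (lvlA K s) SU2 → ℝ}
  {uB : ∀ K : ℕ, ℝ → ∀ s : σ', GaugeField P (lvlB K s) SU2 → ℝ}
  {θA DA ρA θB DB ρB : ℕ → ℝ} {DslotA MA : ℕ → ℝ → σ → ℝ} {DslotB MB : ℕ → ℝ → σ' → ℝ}
  {N₁ : ℕ} {νbar Dbar c₁ ϑ : ℝ} {m : ℕ → ℝ}

/-- **END-I FOR TWO REALIZED `SU(2)` SLOT FAMILIES — THE SEAM CLOSED.**  Per run X ∈ {A, B}: the binders of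
`ShellMeasureRootComposition.shellWeightBound_of_slotAC` with `μX K t s := (fieldMeasure P (lvlX K s) SU2).withDensity
(FX K t s)`, the `IsFiniteMeasure` instances DISCHARGED inside from seam fact (i) `hFfinX`, the wall (M1) per slot with
SLOT constants `DslotX K t s` (END-II's outputs ∕ the level-0 faces) carried to the level constants `DX (lvlX K s)` by
the displayed majorants `hDslotX` (seam fact (ii)); then (W1) windows + count, `D ≤ D̄`, rate `ρ_j ≤ c₁ϑ^j`,
`0 < ϑ < 1` verbatim.  CONCLUSION: LITERALLY END-I's `T4IndicatorShell.ShellWeightBound l₀ T A B shA shB Wsh`,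
`Wsh K = Σ_{s∈S^A K} D^A_{lvl s}ρ^A_{lvl s} + Σ_{s∈S^B K} D^B_{lvl s}ρ^B_{lvl s}`.  CONDITIONAL on every binder. [folklore] -/
theorem shellWeightBound_of_levelDataSU2
    (hFfinA : ∀ K t s, ∫⁻ U, FA K t s U ∂(fieldMeasure P (lvlA K s) SU2) ≠ ∞)
    (sh_nonnegA : ∀ K t, |t| ≤ l₀ → ∀ τ ∈ T K, 0 ≤ shA K t τ)
    (sh_leA : ∀ K t, |t| ≤ l₀ → ∀ τ ∈ T K, shA K t τ ≤ A K t τ)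
    (coverA : ∀ K t, |t| ≤ l₀ → ∀ τ ∈ T K, shA K t τ ≤ ∑ s ∈ SA K, pieceA K t s τ)
    (hMA : ∀ K t, |t| ≤ l₀ → ∀ s ∈ SA K, 0 ≤ MA K t s)
    (piece_leA : ∀ K t, |t| ≤ l₀ → ∀ s ∈ SA K, ∑ τ ∈ T K, pieceA K t s τ ≤ MA K t s *
      (((fieldMeasure P (lvlA K s) SU2).withDensity (FA K t s))
        {x | θA (lvlA K s) * (1 - ρA (lvlA K s)) ≤ uA K t s x ∧ uA K t s x < θA (lvlA K s)}).toReal)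
    (total_geA : ∀ K t, |t| ≤ l₀ → ∀ s ∈ SA K,
      MA K t s * (((fieldMeasure P (lvlA K s) SU2).withDensity (FA K t s)) Set.univ).toReal ≤ ∑ τ ∈ T K, A K t τ)
    (hDA0 : ∀ j, 0 ≤ DA j) (hρA0 : ∀ j, 0 ≤ ρA j)
    (hDslotA : ∀ K t, |t| ≤ l₀ → ∀ s ∈ SA K, DslotA K t s ≤ DA (lvlA K s))
    (hacA : ∀ K t, |t| ≤ l₀ → ∀ s ∈ SA K,
      SlotAntiConcentration ((fieldMeasure P (lvlA K s) SU2).withDensity (FA K t s)) (uA K t s)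
        (θA (lvlA K s)) (ρA (lvlA K s)) (DslotA K t s))
    (hFfinB : ∀ K t s, ∫⁻ U, FB K t s U ∂(fieldMeasure P (lvlB K s) SU2) ≠ ∞)
    (sh_nonnegB : ∀ K t, |t| ≤ l₀ → ∀ τ ∈ T K, 0 ≤ shB K t τ)
    (sh_leB : ∀ K t, |t| ≤ l₀ → ∀ τ ∈ T K, shB K t τ ≤ B K t τ)
    (coverB : ∀ K t, |t| ≤ l₀ → ∀ τ ∈ T K, shB K t τ ≤ ∑ s ∈ SB K, pieceB K t s τ)
    (hMB : ∀ K t, |t| ≤ l₀ → ∀ s ∈ SB K, 0 ≤ MB K t s)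
    (piece_leB : ∀ K t, |t| ≤ l₀ → ∀ s ∈ SB K, ∑ τ ∈ T K, pieceB K t s τ ≤ MB K t s *
      (((fieldMeasure P (lvlB K s) SU2).withDensity (FB K t s))
        {x | θB (lvlB K s) * (1 - ρB (lvlB K s)) ≤ uB K t s x ∧ uB K t s x < θB (lvlB K s)}).toReal)
    (total_geB : ∀ K t, |t| ≤ l₀ → ∀ s ∈ SB K,
      MB K t s * (((fieldMeasure P (lvlB K s) SU2).withDensity (FB K t s)) Set.univ).toReal ≤ ∑ τ ∈ T K, B K t τ)
    (hDB0 : ∀ j, 0 ≤ DB j) (hρB0 : ∀ j, 0 ≤ ρB j)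
    (hDslotB : ∀ K t, |t| ≤ l₀ → ∀ s ∈ SB K, DslotB K t s ≤ DB (lvlB K s))
    (hacB : ∀ K t, |t| ≤ l₀ → ∀ s ∈ SB K,
      SlotAntiConcentration ((fieldMeasure P (lvlB K s) SU2).withDensity (FB K t s)) (uB K t s)
        (θB (lvlB K s)) (ρB (lvlB K s)) (DslotB K t s))
    (hwA : LiveWindow SA lvlA N₁ νbar) (hwB : LiveWindow SB lvlB N₁ νbar) (hϑ0 : 0 < ϑ) (hϑ1 : ϑ < 1)
    (hDA : ∀ j, DA j ≤ Dbar) (hDB : ∀ j, DB j ≤ Dbar)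
    (hrateA : ∀ j, ρA j ≤ c₁ * ϑ ^ j) (hrateB : ∀ j, ρB j ≤ c₁ * ϑ ^ j) :
    ShellWeightBound l₀ T A B shA shB
      (fun K => ∑ s ∈ SA K, DA (lvlA K s) * ρA (lvlA K s) + ∑ s ∈ SB K, DB (lvlB K s) * ρB (lvlB K s)) :=
  haveI : ∀ K t s, IsFiniteMeasure ((fieldMeasure P (lvlA K s) SU2).withDensity (FA K t s)) :=
    fun K t s => isFiniteMeasure_withDensity (hFfinA K t s)
  haveI : ∀ K t s, IsFiniteMeasure ((fieldMeasure P (lvlB K s) SU2).withDensity (FB K t s)) :=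
    fun K t s => isFiniteMeasure_withDensity (hFfinB K t s)
  shellWeightBound_of_slotAC (μA := fun K t s => (fieldMeasure P (lvlA K s) SU2).withDensity (FA K t s))
    (μB := fun K t s => (fieldMeasure P (lvlB K s) SU2).withDensity (FB K t s))
    sh_nonnegA sh_leA coverA hMA piece_leA total_geA hDA0 hρA0 (hac_of_levelData hρA0 hDslotA hacA)
    sh_nonnegB sh_leB coverB hMB piece_leB total_geB hDB0 hρB0 (hac_of_levelData hρB0 hDslotB hacB)
    hwA hwB hϑ0 hϑ1 hDA hDB hrateA hrateB

/-- **… BAND TWIN (road P2's head, trigger c6).**  The same with `Summable ρ^A`, `Summable ρ^B` and age-resolved slot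
counts in place of the geometric rate (`ShellMeasureRootComposition.shellWeightBound_of_slotAC_band`). [folklore] -/
theorem shellWeightBound_of_levelDataSU2_band
    (hFfinA : ∀ K t s, ∫⁻ U, FA K t s U ∂(fieldMeasure P (lvlA K s) SU2) ≠ ∞)
    (sh_nonnegA : ∀ K t, |t| ≤ l₀ → ∀ τ ∈ T K, 0 ≤ shA K t τ)
    (sh_leA : ∀ K t, |t| ≤ l₀ → ∀ τ ∈ T K, shA K t τ ≤ A K t τ)
    (coverA : ∀ K t, |t| ≤ l₀ → ∀ τ ∈ T K, shA K t τ ≤ ∑ s ∈ SA K, pieceA K t s τ)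
    (hMA : ∀ K t, |t| ≤ l₀ → ∀ s ∈ SA K, 0 ≤ MA K t s)
    (piece_leA : ∀ K t, |t| ≤ l₀ → ∀ s ∈ SA K, ∑ τ ∈ T K, pieceA K t s τ ≤ MA K t s *
      (((fieldMeasure P (lvlA K s) SU2).withDensity (FA K t s))
        {x | θA (lvlA K s) * (1 - ρA (lvlA K s)) ≤ uA K t s x ∧ uA K t s x < θA (lvlA K s)}).toReal)
    (total_geA : ∀ K t, |t| ≤ l₀ → ∀ s ∈ SA K,
      MA K t s * (((fieldMeasure P (lvlA K s) SU2).withDensity (FA K t s)) Set.univ).toReal ≤ ∑ τ ∈ T K, A K t τ)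
    (hDA0 : ∀ j, 0 ≤ DA j) (hρA0 : ∀ j, 0 ≤ ρA j)
    (hDslotA : ∀ K t, |t| ≤ l₀ → ∀ s ∈ SA K, DslotA K t s ≤ DA (lvlA K s))
    (hacA : ∀ K t, |t| ≤ l₀ → ∀ s ∈ SA K,
      SlotAntiConcentration ((fieldMeasure P (lvlA K s) SU2).withDensity (FA K t s)) (uA K t s)
        (θA (lvlA K s)) (ρA (lvlA K s)) (DslotA K t s))
    (hFfinB : ∀ K t s, ∫⁻ U, FB K t s U ∂(fieldMeasure P (lvlB K s) SU2) ≠ ∞)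
    (sh_nonnegB : ∀ K t, |t| ≤ l₀ → ∀ τ ∈ T K, 0 ≤ shB K t τ)
    (sh_leB : ∀ K t, |t| ≤ l₀ → ∀ τ ∈ T K, shB K t τ ≤ B K t τ)
    (coverB : ∀ K t, |t| ≤ l₀ → ∀ τ ∈ T K, shB K t τ ≤ ∑ s ∈ SB K, pieceB K t s τ)
    (hMB : ∀ K t, |t| ≤ l₀ → ∀ s ∈ SB K, 0 ≤ MB K t s)
    (piece_leB : ∀ K t, |t| ≤ l₀ → ∀ s ∈ SB K, ∑ τ ∈ T K, pieceB K t s τ ≤ MB K t s *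
      (((fieldMeasure P (lvlB K s) SU2).withDensity (FB K t s))
        {x | θB (lvlB K s) * (1 - ρB (lvlB K s)) ≤ uB K t s x ∧ uB K t s x < θB (lvlB K s)}).toReal)
    (total_geB : ∀ K t, |t| ≤ l₀ → ∀ s ∈ SB K,
      MB K t s * (((fieldMeasure P (lvlB K s) SU2).withDensity (FB K t s)) Set.univ).toReal ≤ ∑ τ ∈ T K, B K t τ)
    (hDB0 : ∀ j, 0 ≤ DB j) (hρB0 : ∀ j, 0 ≤ ρB j)
    (hDslotB : ∀ K t, |t| ≤ l₀ → ∀ s ∈ SB K, DslotB K t s ≤ DB (lvlB K s))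
    (hacB : ∀ K t, |t| ≤ l₀ → ∀ s ∈ SB K,
      SlotAntiConcentration ((fieldMeasure P (lvlB K s) SU2).withDensity (FB K t s)) (uB K t s)
        (θB (lvlB K s)) (ρB (lvlB K s)) (DslotB K t s))
    (hwA : LiveWindow SA lvlA N₁ νbar) (hwB : LiveWindow SB lvlB N₁ νbar)
    (hDA : ∀ j, DA j ≤ Dbar) (hDB : ∀ j, DB j ≤ Dbar)
    (hmA : ∀ K, ∀ a ≤ N₁, (((SA K).filter fun s => K - lvlA K s = a).card : ℝ) ≤ m a)
    (hmB : ∀ K, ∀ a ≤ N₁, (((SB K).filter fun s => K - lvlB K s = a).card : ℝ) ≤ m a)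
    (hρA : Summable ρA) (hρB : Summable ρB) :
    ShellWeightBound l₀ T A B shA shB
      (fun K => ∑ s ∈ SA K, DA (lvlA K s) * ρA (lvlA K s) + ∑ s ∈ SB K, DB (lvlB K s) * ρB (lvlB K s)) :=
  haveI : ∀ K t s, IsFiniteMeasure ((fieldMeasure P (lvlA K s) SU2).withDensity (FA K t s)) :=
    fun K t s => isFiniteMeasure_withDensity (hFfinA K t s)
  haveI : ∀ K t s, IsFiniteMeasure ((fieldMeasure P (lvlB K s) SU2).withDensity (FB K t s)) :=
    fun K t s => isFiniteMeasure_withDensity (hFfinB K t s)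
  shellWeightBound_of_slotAC_band (μA := fun K t s => (fieldMeasure P (lvlA K s) SU2).withDensity (FA K t s))
    (μB := fun K t s => (fieldMeasure P (lvlB K s) SU2).withDensity (FB K t s))
    sh_nonnegA sh_leA coverA hMA piece_leA total_geA hDA0 hρA0 (hac_of_levelData hρA0 hDslotA hacA)
    sh_nonnegB sh_leB coverB hMB piece_leB total_geB hDB0 hρB0 (hac_of_levelData hρB0 hDslotB hacB)
    hwA hwB hDA hDB hmA hmB hρA hρB

/-- **… THROUGH THE SEAM (ζ′) SOCKET.**  The binders of `shellWeightBound_of_levelDataSU2` PLUS the NE7b half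
`RelWeightBound`, a `ReindexedBudget` on the hybrid cores and four summable producer rates ⇒ `∃ K₀`,
`T4MatchingAssembly.HybridNE7` for the shifted families (`ShellMeasureRootComposition.hybridNE7_tail_of_slotAC`).
[folklore] -/
theorem hybridNE7_tail_of_levelDataSU2 [DecidableEq ι] {vol : ℝ} {Bad : ℕ → ℝ → Finset ι}
    {Cc Rr CcRec RrRec : ℕ → ℝ → ι → ℝ} {ν u' s₂ c₀ r s' W : ℕ → ℝ}
    (hFfinA : ∀ K t s, ∫⁻ U, FA K t s U ∂(fieldMeasure P (lvlA K s) SU2) ≠ ∞)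
    (sh_nonnegA : ∀ K t, |t| ≤ l₀ → ∀ τ ∈ T K, 0 ≤ shA K t τ)
    (sh_leA : ∀ K t, |t| ≤ l₀ → ∀ τ ∈ T K, shA K t τ ≤ A K t τ)
    (coverA : ∀ K t, |t| ≤ l₀ → ∀ τ ∈ T K, shA K t τ ≤ ∑ s ∈ SA K, pieceA K t s τ)
    (hMA : ∀ K t, |t| ≤ l₀ → ∀ s ∈ SA K, 0 ≤ MA K t s)
    (piece_leA : ∀ K t, |t| ≤ l₀ → ∀ s ∈ SA K, ∑ τ ∈ T K, pieceA K t s τ ≤ MA K t s *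
      (((fieldMeasure P (lvlA K s) SU2).withDensity (FA K t s))
        {x | θA (lvlA K s) * (1 - ρA (lvlA K s)) ≤ uA K t s x ∧ uA K t s x < θA (lvlA K s)}).toReal)
    (total_geA : ∀ K t, |t| ≤ l₀ → ∀ s ∈ SA K,
      MA K t s * (((fieldMeasure P (lvlA K s) SU2).withDensity (FA K t s)) Set.univ).toReal ≤ ∑ τ ∈ T K, A K t τ)
    (hDA0 : ∀ j, 0 ≤ DA j) (hρA0 : ∀ j, 0 ≤ ρA j)
    (hDslotA : ∀ K t, |t| ≤ l₀ → ∀ s ∈ SA K, DslotA K t s ≤ DA (lvlA K s))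
    (hacA : ∀ K t, |t| ≤ l₀ → ∀ s ∈ SA K,
      SlotAntiConcentration ((fieldMeasure P (lvlA K s) SU2).withDensity (FA K t s)) (uA K t s)
        (θA (lvlA K s)) (ρA (lvlA K s)) (DslotA K t s))
    (hFfinB : ∀ K t s, ∫⁻ U, FB K t s U ∂(fieldMeasure P (lvlB K s) SU2) ≠ ∞)
    (sh_nonnegB : ∀ K t, |t| ≤ l₀ → ∀ τ ∈ T K, 0 ≤ shB K t τ)
    (sh_leB : ∀ K t, |t| ≤ l₀ → ∀ τ ∈ T K, shB K t τ ≤ B K t τ)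
    (coverB : ∀ K t, |t| ≤ l₀ → ∀ τ ∈ T K, shB K t τ ≤ ∑ s ∈ SB K, pieceB K t s τ)
    (hMB : ∀ K t, |t| ≤ l₀ → ∀ s ∈ SB K, 0 ≤ MB K t s)
    (piece_leB : ∀ K t, |t| ≤ l₀ → ∀ s ∈ SB K, ∑ τ ∈ T K, pieceB K t s τ ≤ MB K t s *
      (((fieldMeasure P (lvlB K s) SU2).withDensity (FB K t s))
        {x | θB (lvlB K s) * (1 - ρB (lvlB K s)) ≤ uB K t s x ∧ uB K t s x < θB (lvlB K s)}).toReal)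
    (total_geB : ∀ K t, |t| ≤ l₀ → ∀ s ∈ SB K,
      MB K t s * (((fieldMeasure P (lvlB K s) SU2).withDensity (FB K t s)) Set.univ).toReal ≤ ∑ τ ∈ T K, B K t τ)
    (hDB0 : ∀ j, 0 ≤ DB j) (hρB0 : ∀ j, 0 ≤ ρB j)
    (hDslotB : ∀ K t, |t| ≤ l₀ → ∀ s ∈ SB K, DslotB K t s ≤ DB (lvlB K s))
    (hacB : ∀ K t, |t| ≤ l₀ → ∀ s ∈ SB K,
      SlotAntiConcentration ((fieldMeasure P (lvlB K s) SU2).withDensity (FB K t s)) (uB K t s)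
        (θB (lvlB K s)) (ρB (lvlB K s)) (DslotB K t s))
    (hwA : LiveWindow SA lvlA N₁ νbar) (hwB : LiveWindow SB lvlB N₁ νbar) (hϑ0 : 0 < ϑ) (hϑ1 : ϑ < 1)
    (hDA : ∀ j, DA j ≤ Dbar) (hDB : ∀ j, DB j ≤ Dbar)
    (hrateA : ∀ j, ρA j ≤ c₁ * ϑ ^ j) (hrateB : ∀ j, ρB j ≤ c₁ * ϑ ^ j)
    (hW : RelWeightBound l₀ T A B Bad W)
    (hTB : ReindexedBudget l₀ vol T (fun K t τ => A K t τ - shA K t τ) (fun K t τ => B K t τ - shB K t τ) Bad Cc Rr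
      CcRec RrRec ν u' s₂ c₀ r s')
    (hr : Summable r) (hu : Summable u') (hs : Summable s') (hs₂ : Summable s₂) :
    ∃ K₀, HybridNE7 l₀ vol (fun K => T (K₀ + K)) (fun K => A (K₀ + K)) (fun K => B (K₀ + K)) (fun K => Bad (K₀ + K))
      (fun K => W (K₀ + K)) (fun K => shA (K₀ + K)) (fun K => shB (K₀ + K))
      (fun K => ∑ s ∈ SA (K₀ + K), DA (lvlA (K₀ + K) s) * ρA (lvlA (K₀ + K) s) +
        ∑ s ∈ SB (K₀ + K), DB (lvlB (K₀ + K) s) * ρB (lvlB (K₀ + K) s))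
      (fun K => (r (K₀ + K) + u' (K₀ + K)) + (s' (K₀ + K) + s₂ (K₀ + K))) :=
  haveI : ∀ K t s, IsFiniteMeasure ((fieldMeasure P (lvlA K s) SU2).withDensity (FA K t s)) :=
    fun K t s => isFiniteMeasure_withDensity (hFfinA K t s)
  haveI : ∀ K t s, IsFiniteMeasure ((fieldMeasure P (lvlB K s) SU2).withDensity (FB K t s)) :=
    fun K t s => isFiniteMeasure_withDensity (hFfinB K t s)
  hybridNE7_tail_of_slotAC (μA := fun K t s => (fieldMeasure P (lvlA K s) SU2).withDensity (FA K t s))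
    (μB := fun K t s => (fieldMeasure P (lvlB K s) SU2).withDensity (FB K t s))
    sh_nonnegA sh_leA coverA hMA piece_leA total_geA hDA0 hρA0 (hac_of_levelData hρA0 hDslotA hacA)
    sh_nonnegB sh_leB coverB hMB piece_leB total_geB hDB0 hρB0 (hac_of_levelData hρB0 hDslotB hacB)
    hwA hwB hϑ0 hϑ1 hDA hDB hrateA hrateB hW hTB hr hu hs hs₂

end TwoRuns

end Summit.QuantumFields.BalabanUV.T4Continuum.ShellMeasureRootCompositionSeam
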